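import Mathlib
import Summits.Langlands.Langlands.Statement
import Summits.Langlands.Langlands.Theorems.SoloInformedPstScalarTwist
import Literature.NumberTheory.PAdicHodge.FontaineDpst
import Literature.NumberTheory.PAdicHodge.BdRCyclotomic
import Literature.NumberTheory.PAdicHodge.BdRUnramified

/-!
# The specification `IsFontaineDatum` does not determine `WD ∘ D_pst`

Solo seat `solo-Langlands-informed`, session 48 (question Q2 of the seat's PLAN: "does the pinned
`IsFontaineDatum` fix `WD ∘ D_pst` up to isomorphism?").  Answer: **no**, and the failure is visible
on the cyclotomic character already.

Let `𝔇` be any `p`-adic Hodge datum (`PstWeilDeligneData F ℓ`) and `c ∈ ℚ̄_ℓˣ`.  The datum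
`twistOff 𝔇 c` has the same `ℚ_ℓ`-structure and the same period ring as `𝔇`, agrees with `𝔇` on
locally unramified `ρ`, and OFF the locally unramified locus attaches to `ρ` the unramified scalar
twist `scalarTwist c r = (w ↦ c ^ deg w • r(w), N)` (tool file `SoloInformedPstScalarTwist`) of what
`𝔇` attaches.  Then:

* `twistOff 𝔇 c` is again a `PstWeilDeligneData` (the five structure axioms transfer);
* `IsCrystallineFramed` is the SAME predicate for `𝔇` and `twistOff 𝔇 c`
  (`isCrystallineFramed_twistOff_iff`), hence so is every crystalline deformation ring, and
* **every clause (F1)–(F14) of `IsFontaineDatum` transfers** (`IsFontaineDatum.twistOff`): the clauses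
  see `𝔇` only through its `ℚ_ℓ`-structure, its period ring, `IsCrystallineFramed`, and
  `IsWeilDeligneOf` on locally unramified representations (F8);
* but for a de Rham `ρ` of rank `n ≥ 1` which is NOT locally unramified and `c ^ n ≠ 1`, the classes
  attached by `𝔇` and by `twistOff 𝔇 c` are never isomorphic (`not_isEquivalent_scalarTwist`:
  compare determinants at a Weil element of degree `1`).

Consequences (`isFontaineDatum_not_categorical`, `fontainePst_twistOff_disagree`,
`no_weilDeligne_class_forced_by_spec`): under Fontaine's existence theorem `FontaineDatumExists`, THE
pinned datum `fontainePst F ℓ hℓ` of the summit statement has a twin satisfying the full specification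
and contradicting it on the cyclotomic character `Γ_F → GL₁(ℚ̄_ℓ)` (which is de Rham of weight `-1` and,
by the unconditional Hodge–Tate weight computations of `BdRCyclotomic`/`BdRUnramified`, not locally
unramified).  Since `fontainePst` is Hilbert's `ε` over exactly this specification, no statement of the
form "`(fontainePst F ℓ hℓ).IsWeilDeligneOf ρ r` for an `r` in a prescribed isomorphism class" is
derivable from the clauses for any de Rham `ρ` that is ramified at `ℓ` — in particular the `v ∣ ℓ`
clause of `LocalGlobalCompatibleAt` for any `π` whose `ρ_{π,ι}|_{Γ_{K_v}}` has a non-zero Hodge–Tate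
weight.  The remedy is definition item D2 (`B_st`, `D_pst`, Fontaine's recipe) or a clause pinning
`IsWeilDeligneOf` beyond (F8); this file only proves the object-level non-categoricity.
Elementary given the tree's API; no external citation is load-bearing (Fontaine 1994, Exp. VIII
§2.3.7 for what D2 must construct).
-/

noncomputable section

open Literature.NumberTheory.GaloisRepresentations Literature.NumberTheory.PAdicHodge Field ValuativeRel
  IsDedekindDomain
open scoped NumberField

namespace Summit.Langlands.Langlands.Theorems

namespace PstSpecTwist

/-! ### Twisting a `p`-adic Hodge datum off the locally unramified locus -/

section Datum

variable {F : Type} [Field F] [ValuativeRel F] [TopologicalSpace F] [IsNonarchimedeanLocalField F]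
  {ℓ : ℕ} [Fact ℓ.Prime]

/-- Being locally unramified is invariant under a change of frame. -/
theorem isLocallyUnramified_conj_iff {n : ℕ} (g : GL (Fin n) (PadicAlgCl ℓ))
    (ρ : FramedRep (absoluteGaloisGroup F) (PadicAlgCl ℓ) n) :
    (FramedRep.conj g ρ).IsLocallyUnramified ↔ ρ.IsLocallyUnramified := by
  simp only [FramedRep.IsLocallyUnramified, FramedRep.conj_apply, conj_eq_one_iff]

/-- **The twisted datum** `twistOff 𝔇 c`: same `ℚ_ℓ`-structure, same period ring; on locally unramified
`ρ` it attaches what `𝔇` attaches, and otherwise the unramified scalar twists `r₀ ⊗ c^deg` of the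
representations `r₀` that `𝔇` attaches. -/
def twistOff (𝔇 : PstWeilDeligneData F ℓ) (c : (PadicAlgCl ℓ)ˣ) : PstWeilDeligneData F ℓ where
  algebra := 𝔇.algebra
  𝔅 := 𝔇.𝔅
  IsWeilDeligneOf := fun {n} ρ r =>
    (ρ.IsLocallyUnramified → 𝔇.IsWeilDeligneOf ρ r) ∧
    (¬ ρ.IsLocallyUnramified →
      ∃ r₀ : WeilDeligneRep F (PadicAlgCl ℓ) (Fin n → PadicAlgCl ℓ),
        𝔇.IsWeilDeligneOf ρ r₀ ∧ r.IsEquivalent (scalarTwist c r₀))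
  exists_of_isDeRham := fun ρ hρ => by
    obtain ⟨r₀, h₀⟩ := 𝔇.exists_of_isDeRham ρ hρ
    by_cases hu : ρ.IsLocallyUnramified
    · exact ⟨r₀, fun _ => h₀, fun h => (h hu).elim⟩
    · exact ⟨scalarTwist c r₀, fun h => (hu h).elim, fun _ => ⟨r₀, h₀, WeilDeligneRep.IsEquivalent.refl _⟩⟩
  isEquivalent := fun ρ r r' h h' => by
    by_cases hu : ρ.IsLocallyUnramified
    · exact 𝔇.isEquivalent ρ r r' (h.1 hu) (h'.1 hu)
    · obtain ⟨r₀, h₀, e₀⟩ := h.2 hu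
      obtain ⟨r₁, h₁, e₁⟩ := h'.2 hu
      exact (e₀.trans (isEquivalent_scalarTwist (𝔇.isEquivalent ρ r₀ r₁ h₀ h₁) c)).trans e₁.symm
  conj := fun g ρ r h => by
    refine ⟨fun hu => 𝔇.conj g ρ r (h.1 ((isLocallyUnramified_conj_iff g ρ).1 hu)), fun hu => ?_⟩
    obtain ⟨r₀, h₀, e₀⟩ := h.2 (fun h' => hu ((isLocallyUnramified_conj_iff g ρ).2 h'))
    exact ⟨r₀, 𝔇.conj g ρ r₀ h₀, e₀⟩
  isDeRhamWith_of_isLocallyUnramified := fun ρ hρ => 𝔇.isDeRhamWith_of_isLocallyUnramified ρ hρ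
  wd_of_isLocallyUnramified := fun ρ r hu h => 𝔇.wd_of_isLocallyUnramified ρ r hu (h.1 hu)

variable (𝔇 : PstWeilDeligneData F ℓ) (c : (PadicAlgCl ℓ)ˣ)

/-- Same `ℚ_ℓ`-structure. -/
@[simp] theorem twistOff_algebra : (twistOff 𝔇 c).algebra = 𝔇.algebra := rfl

/-- Same period ring. -/
@[simp] theorem twistOff_𝔅 : (twistOff 𝔇 c).𝔅 = 𝔇.𝔅 := rfl

/-- On locally unramified representations the twisted datum attaches what `𝔇` attaches. -/
theorem twistOff_isWeilDeligneOf_of_isLocallyUnramified {n : ℕ}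
    {ρ : FramedRep (absoluteGaloisGroup F) (PadicAlgCl ℓ) n} (hρ : ρ.IsLocallyUnramified)
    (r : WeilDeligneRep F (PadicAlgCl ℓ) (Fin n → PadicAlgCl ℓ)) :
    (twistOff 𝔇 c).IsWeilDeligneOf ρ r ↔ 𝔇.IsWeilDeligneOf ρ r :=
  ⟨fun h => h.1 hρ, fun h => ⟨fun _ => h, fun h' => (h' hρ).elim⟩⟩

/-- Off the locally unramified locus the twisted datum attaches exactly the twists. -/
theorem twistOff_isWeilDeligneOf_of_not_isLocallyUnramified {n : ℕ}
    {ρ : FramedRep (absoluteGaloisGroup F) (PadicAlgCl ℓ) n} (hρ : ¬ ρ.IsLocallyUnramified)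
    (r : WeilDeligneRep F (PadicAlgCl ℓ) (Fin n → PadicAlgCl ℓ)) :
    (twistOff 𝔇 c).IsWeilDeligneOf ρ r ↔
      ∃ r₀ : WeilDeligneRep F (PadicAlgCl ℓ) (Fin n → PadicAlgCl ℓ),
        𝔇.IsWeilDeligneOf ρ r₀ ∧ r.IsEquivalent (scalarTwist c r₀) :=
  ⟨fun h => h.2 hρ, fun h => ⟨fun h' => (hρ h').elim, fun _ => h⟩⟩

/-- De Rham-ness is literally the same notion for `𝔇` and its twist. -/
theorem isDeRhamFramed_twistOff_iff {n : ℕ} (ρ : FramedRep (absoluteGaloisGroup F) (PadicAlgCl ℓ) n) :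
    (twistOff 𝔇 c).IsDeRhamFramed ρ ↔ 𝔇.IsDeRhamFramed ρ := Iff.rfl

/-- **Crystallinity is the same predicate** for `𝔇` and `twistOff 𝔇 c`: the twist by `c ^ deg`
preserves and reflects "`N = 0`, inertia trivial", and isomorphisms transport it. -/
theorem isCrystallineFramed_twistOff_iff {n : ℕ}
    (ρ : FramedRep (absoluteGaloisGroup F) (PadicAlgCl ℓ) n) :
    (twistOff 𝔇 c).IsCrystallineFramed ρ ↔ 𝔇.IsCrystallineFramed ρ := by
  unfold PstWeilDeligneData.IsCrystallineFramed
  refine and_congr Iff.rfl ?_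
  by_cases hu : ρ.IsLocallyUnramified
  · constructor
    · rintro ⟨r, hr, h0⟩
      exact ⟨r, hr.1 hu, h0⟩
    · rintro ⟨r, hr, h0⟩
      exact ⟨r, ⟨fun _ => hr, fun h => (h hu).elim⟩, h0⟩
  · constructor
    · rintro ⟨r, hr, h0⟩
      obtain ⟨r₀, h₀, e⟩ := hr.2 hu
      exact ⟨r₀, h₀, (scalarTwist_unram_iff c r₀).1 (unram_of_isEquivalent e h0)⟩
    · rintro ⟨r₀, h₀, h0⟩
      exact ⟨scalarTwist c r₀, ⟨fun h => (hu h).elim, fun _ => ⟨r₀, h₀, WeilDeligneRep.IsEquivalent.refl _⟩⟩,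
        (scalarTwist_unram_iff c r₀).2 h0⟩

/-- The conjunction "crystalline and `H`" is the same function for `𝔇` and its twist — the only way the
datum enters a crystalline deformation ring (`CrystallineDeformationRing … 𝔇 H`). -/
theorem isCrystallineFramed_and_twistOff_eq (n : ℕ)
    (H : FramedRep (absoluteGaloisGroup F) (PadicAlgCl ℓ) n → Prop) :
    (fun ρ : FramedRep (absoluteGaloisGroup F) (PadicAlgCl ℓ) n =>
        (twistOff 𝔇 c).IsCrystallineFramed ρ ∧ H ρ) =
      fun ρ => 𝔇.IsCrystallineFramed ρ ∧ H ρ :=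
  funext fun ρ => propext (and_congr (isCrystallineFramed_twistOff_iff 𝔇 c ρ) Iff.rfl)

/-- Crystalline deformation rings relative to `𝔇` and to `twistOff 𝔇 c` are the same TYPE. -/
theorem crystallineDeformationRing_twistOff_eq {n : ℕ} (O : Type) [CommRing O]
    [Algebra O (PadicAlgCl ℓ)] (k : Type) [Field k] [Algebra O k] [TopologicalSpace k]
    (ρbar : FramedRep (absoluteGaloisGroup F) k n)
    (H : FramedRep (absoluteGaloisGroup F) (PadicAlgCl ℓ) n → Prop) :
    CrystallineDeformationRing ℓ F O k ρbar (twistOff 𝔇 c) H =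
      CrystallineDeformationRing ℓ F O k ρbar 𝔇 H := by
  unfold CrystallineDeformationRing
  rw [isCrystallineFramed_and_twistOff_eq]

/-- Compatible crystalline extension data transport from `𝔇` to its twist (same tower `𝔅`). -/
def pstCrystallineExtensionData_twistOff (𝔈 : PstCrystallineExtensionData 𝔇) :
    PstCrystallineExtensionData (twistOff 𝔇 c) where
  𝔅 := 𝔈.𝔅
  isCrystallineFn_restrictField := fun ρ K' hK' hρ =>
    𝔈.isCrystallineFn_restrictField ρ K' hK' ((isCrystallineFramed_twistOff_iff 𝔇 c ρ).1 hρ)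
  isCrystallineFramed_of_isCrystallineFn_bot := fun ρ h =>
    (isCrystallineFramed_twistOff_iff 𝔇 c ρ).2 (𝔈.isCrystallineFramed_of_isCrystallineFn_bot ρ h)
  isCrystallineFn_restrictField_of_le := fun K' K'' hle hK' hK'' ρ h =>
    𝔈.isCrystallineFn_restrictField_of_le K' K'' hle hK' hK'' ρ h
  labelledHodgeTateWeights_bot_eq := fun ρ τ hρ hF₀ =>
    𝔈.labelledHodgeTateWeights_bot_eq ρ τ ((isCrystallineFramed_twistOff_iff 𝔇 c ρ).1 hρ) hF₀

/-- **Every clause of Fontaine's specification transfers to the twisted datum.** -/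
theorem isFontaineDatum_twistOff [CharZero F]
    {hℓ : valuation F ℓ < 1} {𝔇 : PstWeilDeligneData F ℓ} (h : IsFontaineDatum hℓ 𝔇)
    (c : (PadicAlgCl ℓ)ˣ) : IsFontaineDatum hℓ (twistOff 𝔇 c) where
  algebra_eq := h.algebra_eq
  cyclotomicWeightNegOne := h.cyclotomicWeightNegOne
  unramifiedWeightsZero := fun ρ hρ => h.unramifiedWeightsZero ρ hρ
  isCrystallineFramed_cyclotomic :=
    (isCrystallineFramed_twistOff_iff 𝔇 c _).2 h.isCrystallineFramed_cyclotomic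
  hasCrystallineDeformationRings := by
    intro L _ n ρbar a b hex
    rw [crystallineDeformationRing_twistOff_eq]
    refine h.hasCrystallineDeformationRings L n ρbar a b ?_
    obtain ⟨ρ, h1, h2, h3⟩ := hex
    exact ⟨ρ, h1, (isCrystallineFramed_twistOff_iff 𝔇 c ρ).1 h2, h3⟩
  hasHodgeTypeCrystallineDeformationRings := by
    intro L _ hL n ρbar v hex
    rw [crystallineDeformationRing_twistOff_eq]
    refine h.hasHodgeTypeCrystallineDeformationRings L hL n ρbar v ?_
    obtain ⟨ρ, h1, h2, h3⟩ := hex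
    exact ⟨ρ, h1, (isCrystallineFramed_twistOff_iff 𝔇 c ρ).1 h2, h3⟩
  crystallineGenericFibreRegular := by
    intro L _ hL n ρbar v
    have h7 := h.crystallineGenericFibreRegular L hL n ρbar v
    unfold CrystallineDeformationRing at h7 ⊢
    rw [isCrystallineFramed_and_twistOff_eq]
    exact h7
  isEquivalent_weilRestrict_of_isLocallyUnramified := fun ρ r hρ hr =>
    h.isEquivalent_weilRestrict_of_isLocallyUnramified ρ r hρ (hr.1 hρ)
  periodRing_eq_bdR := h.periodRing_eq_bdR
  nonempty_pstCrystallineExtensionData := by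
    obtain ⟨𝔈⟩ := h.nonempty_pstCrystallineExtensionData
    exact ⟨pstCrystallineExtensionData_twistOff 𝔇 c 𝔈⟩
  cyclotomicPowersLabelledWeights := h.cyclotomicPowersLabelledWeights
  crystallineDetOnInertia := fun hsurj n ρ τ hρ =>
    h.crystallineDetOnInertia hsurj ρ τ ((isCrystallineFramed_twistOff_iff 𝔇 c ρ).1 hρ)
  fontaineLaffailleReductions := fun hsurj n ρ τ w₀ hρ =>
    h.fontaineLaffailleReductions hsurj ρ τ w₀ ((isCrystallineFramed_twistOff_iff 𝔇 c ρ).1 hρ)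
  isCrystallineFramed_of_ordinary_regular := fun n art hart ρ wt hdom hreg hex =>
    (isCrystallineFramed_twistOff_iff 𝔇 c ρ).2
      (h.isCrystallineFramed_of_ordinary_regular n art hart ρ wt hdom hreg hex)

/-- **Disagreement off the unramified locus.** For a de Rham `ρ` of rank `n` which is not locally
unramified and `c ^ n ≠ 1`, no representation attached to `ρ` by `𝔇` is isomorphic to one attached by
`twistOff 𝔇 c`. -/
theorem twistOff_disagree {n : ℕ} {ρ : FramedRep (absoluteGaloisGroup F) (PadicAlgCl ℓ) n}
    (hρ : ¬ ρ.IsLocallyUnramified) (hc : (c : PadicAlgCl ℓ) ^ n ≠ 1)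
    (r r' : WeilDeligneRep F (PadicAlgCl ℓ) (Fin n → PadicAlgCl ℓ))
    (hr : 𝔇.IsWeilDeligneOf ρ r) (hr' : (twistOff 𝔇 c).IsWeilDeligneOf ρ r') :
    ¬ r.IsEquivalent r' := by
  intro e
  obtain ⟨r₀, h₀, e₀⟩ := hr'.2 hρ
  -- `r ≅ r' ≅ r₀ ⊗ c^deg ≅ r ⊗ c^deg`
  have e₁ : r.IsEquivalent (scalarTwist c r) :=
    (e.trans e₀).trans (isEquivalent_scalarTwist (𝔇.isEquivalent ρ r₀ r h₀ hr) c)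
  refine not_isEquivalent_scalarTwist r c ?_ e₁
  simpa only [Module.finrank_fintype_fun_eq_card, Fintype.card_fin] using hc

/-- `2 ^ n ≠ 1` in `ℚ̄_ℓ` for `n ≥ 1`. -/
theorem two_pow_ne_one {n : ℕ} (hn : 0 < n) :
    ((Units.mk0 (2 : PadicAlgCl ℓ) two_ne_zero : (PadicAlgCl ℓ)ˣ) : PadicAlgCl ℓ) ^ n ≠ 1 := by
  haveI : CharZero (PadicAlgCl ℓ) :=
    charZero_of_injective_algebraMap (algebraMap ℚ_[ℓ] (PadicAlgCl ℓ)).injective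
  rw [Units.val_mk0]
  intro h'
  have h2 : ((2 ^ n : ℕ) : PadicAlgCl ℓ) = ((1 : ℕ) : PadicAlgCl ℓ) := by simpa using h'
  exact (Nat.one_lt_two_pow_iff.mpr hn.ne').ne' (Nat.cast_injective h2)

/-- **Non-categoricity of the specification** (rank-general form): a datum with Fontaine's clauses, a
de Rham `ρ` of rank `n ≥ 1` that is not locally unramified ⟹ a second datum with the clauses, on the
same `ℚ_ℓ`-structure and period ring, whose attached Weil–Deligne representations for `ρ` are
disjoint from the first datum's up to isomorphism. -/
theorem isFontaineDatum_not_categorical [CharZero F] (hℓ : valuation F ℓ < 1)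
    {𝔇 : PstWeilDeligneData F ℓ} (h : IsFontaineDatum hℓ 𝔇) {n : ℕ} (hn : 0 < n)
    {ρ : FramedRep (absoluteGaloisGroup F) (PadicAlgCl ℓ) n} (hρ : ¬ ρ.IsLocallyUnramified) :
    ∃ 𝔇' : PstWeilDeligneData F ℓ, IsFontaineDatum hℓ 𝔇' ∧ 𝔇'.algebra = 𝔇.algebra ∧
      (∀ ρ₀ : FramedRep (absoluteGaloisGroup F) (PadicAlgCl ℓ) n,
        (𝔇'.IsDeRhamFramed ρ₀ ↔ 𝔇.IsDeRhamFramed ρ₀) ∧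
        (𝔇'.IsCrystallineFramed ρ₀ ↔ 𝔇.IsCrystallineFramed ρ₀)) ∧
      ∀ r r' : WeilDeligneRep F (PadicAlgCl ℓ) (Fin n → PadicAlgCl ℓ),
        𝔇.IsWeilDeligneOf ρ r → 𝔇'.IsWeilDeligneOf ρ r' → ¬ r.IsEquivalent r' :=
  ⟨twistOff 𝔇 (Units.mk0 2 two_ne_zero), isFontaineDatum_twistOff h _, rfl,
    fun ρ₀ => ⟨Iff.rfl, isCrystallineFramed_twistOff_iff 𝔇 _ ρ₀⟩,
    fun r r' hr hr' => twistOff_disagree 𝔇 _ hρ (two_pow_ne_one hn) r r' hr hr'⟩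

/-! ### The cyclotomic character is not locally unramified (unconditionally) -/

/-- **`ε_ℓ|_{Γ_F}` is ramified** for a characteristic-`0` local field `F` of residue characteristic
`ℓ`: its `B_dR(F)`-Hodge–Tate weight is `-1` (`hodgeTateWeights_bdR_cyclotomicRepQp_padicAlgebra`),
whereas a representation trivial on inertia has all weights `0` (`hodgeTateWeights_bdR_of_unramified`). -/
theorem not_isLocallyUnramified_cyclotomic [CharZero F] (hℓ : valuation F ℓ < 1) :
    ¬ (FramedGaloisRep.cyclotomicPadicAlgCl F ℓ).IsLocallyUnramified := by
  intro hu
  letI := LocalField.padicAlgebra F ℓ hℓ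
  haveI : Fact (¬ IsUnit ((ℓ : ℕ) : integerC F)) := ⟨not_isUnit_natCast_integerC hℓ⟩
  haveI := isAdicComplete_integerC_natCast (F := F) hℓ
  have h1 := hodgeTateWeights_bdR_cyclotomicRepQp_padicAlgebra (F := F) hℓ
  have h2 := hodgeTateWeights_bdR_of_unramified (F := F) hℓ (cyclotomicRepQp F ℓ) (by
    intro σ hσ v
    have h00 := congrArg
      (fun M : GL (Fin 1) (PadicAlgCl ℓ) => (M : Matrix (Fin 1) (Fin 1) (PadicAlgCl ℓ)) 0 0) (hu σ hσ)
    simp only [FramedGaloisRep.cyclotomicPadicAlgCl_apply_coe, Units.val_one,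
      Matrix.one_apply_eq] at h00
    have hε : (((GaloisRep.cyclotomicCharacter F ℓ σ : ℤ_[ℓ]ˣ) : ℤ_[ℓ]) : ℚ_[ℓ]) = 1 :=
      (algebraMap ℚ_[ℓ] (PadicAlgCl ℓ)).injective (by rw [h00, map_one])
    change ((((GaloisRep.cyclotomicCharacter F ℓ σ : ℤ_[ℓ]ˣ) : ℤ_[ℓ]) : ℚ_[ℓ]) •
      (LinearMap.id : ℚ_[ℓ] →ₗ[ℚ_[ℓ]] ℚ_[ℓ])) v = v
    rw [hε, one_smul, LinearMap.id_apply])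
  rw [h1, Module.finrank_self] at h2
  simp at h2

/-- **The specification is not categorical, witnessed by the cyclotomic character**: for every datum
with Fontaine's clauses there is another, with the clauses, the same `ℚ_ℓ`-structure and the same
period ring `B_dR(F)`, attaching to `ε_ℓ : Γ_F → GL₁(ℚ̄_ℓ)` a class disjoint from the first one's. -/
theorem isFontaineDatum_not_categorical_cyclotomic [CharZero F] (hℓ : valuation F ℓ < 1)
    {𝔇 : PstWeilDeligneData F ℓ} (h : IsFontaineDatum hℓ 𝔇) :
    ∃ 𝔇' : PstWeilDeligneData F ℓ, IsFontaineDatum hℓ 𝔇' ∧ 𝔇'.algebra = 𝔇.algebra ∧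
      (∃ r, 𝔇.IsWeilDeligneOf (FramedGaloisRep.cyclotomicPadicAlgCl F ℓ) r) ∧
      (∃ r', 𝔇'.IsWeilDeligneOf (FramedGaloisRep.cyclotomicPadicAlgCl F ℓ) r') ∧
      ∀ r r', 𝔇.IsWeilDeligneOf (FramedGaloisRep.cyclotomicPadicAlgCl F ℓ) r →
        𝔇'.IsWeilDeligneOf (FramedGaloisRep.cyclotomicPadicAlgCl F ℓ) r' → ¬ r.IsEquivalent r' := by
  obtain ⟨𝔇', h', halg, hdR, hdis⟩ :=
    isFontaineDatum_not_categorical hℓ h Nat.one_pos (not_isLocallyUnramified_cyclotomic hℓ)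
  have hε : 𝔇.IsDeRhamFramed (FramedGaloisRep.cyclotomicPadicAlgCl F ℓ) :=
    h.cyclotomicWeightNegOne.isDeRhamFramed
  exact ⟨𝔇', h', halg, 𝔇.exists_of_isDeRham _ hε, 𝔇'.exists_of_isDeRham _ ((hdR _).1.2 hε), hdis⟩

/-- **THE pinned datum has a specification-twin contradicting it on `ε_ℓ`** (under Fontaine's
existence theorem, which is what makes `fontainePst` satisfy its own specification). -/
theorem fontainePst_twistOff_disagree [CharZero F] (hℓ : valuation F ℓ < 1)
    (hE : FontaineDatumExists) :
    IsFontaineDatum hℓ (twistOff (fontainePst F ℓ hℓ) (Units.mk0 2 two_ne_zero)) ∧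
      (∃ r, (fontainePst F ℓ hℓ).IsWeilDeligneOf (FramedGaloisRep.cyclotomicPadicAlgCl F ℓ) r) ∧
      ∀ r r', (fontainePst F ℓ hℓ).IsWeilDeligneOf (FramedGaloisRep.cyclotomicPadicAlgCl F ℓ) r →
        (twistOff (fontainePst F ℓ hℓ) (Units.mk0 2 two_ne_zero)).IsWeilDeligneOf
          (FramedGaloisRep.cyclotomicPadicAlgCl F ℓ) r' → ¬ r.IsEquivalent r' := by
  have h := isFontaineDatum_fontainePst (F := F) hE hℓ
  exact ⟨isFontaineDatum_twistOff h _,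
    (fontainePst F ℓ hℓ).exists_of_isDeRham _ h.cyclotomicWeightNegOne.isDeRhamFramed,
    fun r r' hr hr' => twistOff_disagree _ _ (not_isLocallyUnramified_cyclotomic hℓ)
      (two_pow_ne_one Nat.one_pos) r r' hr hr'⟩

/-- **No Weil–Deligne class is forced on `ε_ℓ` by the specification**: there is no `r` such that every
datum with Fontaine's clauses (on `B_dR(F)`, canonical `ℚ_ℓ`-structure — the data Hilbert's `ε` in
`fontainePst` ranges over) attaches to the cyclotomic character a representation isomorphic to `r`.
This is the object-level shadow of: "`(fontainePst F ℓ hℓ).IsWeilDeligneOf ε r` with `r` in a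
prescribed class is underivable from the clauses". -/
theorem no_weilDeligne_class_forced_by_spec [CharZero F] (hℓ : valuation F ℓ < 1)
    (hE : FontaineDatumExists) (r : WeilDeligneRep F (PadicAlgCl ℓ) (Fin 1 → PadicAlgCl ℓ)) :
    ¬ ∀ 𝔇 : PstWeilDeligneData F ℓ, IsFontaineDatum hℓ 𝔇 →
        ∃ r', 𝔇.IsWeilDeligneOf (FramedGaloisRep.cyclotomicPadicAlgCl F ℓ) r' ∧ r'.IsEquivalent r := by
  intro hall
  obtain ⟨𝔇, h𝔇⟩ := hE F ℓ hℓ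
  obtain ⟨𝔇', h', -, -, -, hdis⟩ := isFontaineDatum_not_categorical_cyclotomic hℓ h𝔇
  obtain ⟨r₁, h₁, e₁⟩ := hall 𝔇 h𝔇
  obtain ⟨r₂, h₂, e₂⟩ := hall 𝔇' h'
  exact hdis r₁ r₂ h₁ h₂ (e₁.trans e₂.symm)

end Datum

/-! ### The summit's datum `𝓡.pst ℓ v hv` -/

section Summit

variable {K : Type} [Field K] [NumberField K]

/-- **The summit's pinned datum at `v ∣ ℓ` has a specification-twin contradicting it on `ε_ℓ`**
(under `FontaineDatumExists`): `Summit.Langlands.ReciprocityData.pst 𝓡 ℓ v hv` is by definition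
`fontainePst (K_v) ℓ _`, so `twistOff (𝓡.pst ℓ v hv) 2` satisfies every clause the pin is chosen
over and attaches to the cyclotomic character of `Γ_{K_v}` a class disjoint from the pinned one.
Hence the `v ∣ ℓ` conjunct `(𝓡.pst ℓ v hv).IsWeilDeligneOf (ρ.toLocal v) r` of
`LocalGlobalCompatibleAt` is, for `ρ.toLocal v` de Rham and not locally unramified, not settled by
the clauses of `IsFontaineDatum` — only by the construction D2. -/
theorem reciprocityData_pst_twistOff_disagree (hE : FontaineDatumExists) (𝓡 : ReciprocityData K)
    (ℓ : ℕ) [Fact ℓ.Prime] (v : HeightOneSpectrum (𝓞 K)) (hv : ((ℓ : ℕ) : 𝓞 K) ∈ v.asIdeal) :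
    haveI := LocalField.charZero_adicCompletion v
    IsFontaineDatum (LocalField.valuation_adicCompletion_natCast_lt_one v ℓ hv)
        (twistOff (𝓡.pst ℓ v hv) (Units.mk0 2 two_ne_zero)) ∧
      (∃ r, (𝓡.pst ℓ v hv).IsWeilDeligneOf
        (FramedGaloisRep.cyclotomicPadicAlgCl (v.adicCompletion K) ℓ) r) ∧
      ∀ r r', (𝓡.pst ℓ v hv).IsWeilDeligneOf
          (FramedGaloisRep.cyclotomicPadicAlgCl (v.adicCompletion K) ℓ) r →
        (twistOff (𝓡.pst ℓ v hv) (Units.mk0 2 two_ne_zero)).IsWeilDeligneOf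
          (FramedGaloisRep.cyclotomicPadicAlgCl (v.adicCompletion K) ℓ) r' → ¬ r.IsEquivalent r' := by
  haveI := LocalField.charZero_adicCompletion v
  exact fontainePst_twistOff_disagree _ hE

/-- **Two data meeting the pin's specification at `v ∣ ℓ` that no single `r` can serve**: for every
Weil–Deligne representation `r` of rank `1` there is a datum with all of Fontaine's clauses at `K_v`
which does NOT attach (anything isomorphic to) `r` to the cyclotomic character. -/
theorem exists_isFontaineDatum_not_attaching (hE : FontaineDatumExists)
    (ℓ : ℕ) [Fact ℓ.Prime] (v : HeightOneSpectrum (𝓞 K)) (hv : ((ℓ : ℕ) : 𝓞 K) ∈ v.asIdeal)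
    (r : WeilDeligneRep (v.adicCompletion K) (PadicAlgCl ℓ) (Fin 1 → PadicAlgCl ℓ)) :
    haveI := LocalField.charZero_adicCompletion v
    ∃ 𝔇 : PstWeilDeligneData (v.adicCompletion K) ℓ,
      IsFontaineDatum (LocalField.valuation_adicCompletion_natCast_lt_one v ℓ hv) 𝔇 ∧
      ∀ r', 𝔇.IsWeilDeligneOf (FramedGaloisRep.cyclotomicPadicAlgCl (v.adicCompletion K) ℓ) r' →
        ¬ r'.IsEquivalent r := by
  haveI := LocalField.charZero_adicCompletion v
  by_contra hcon
  push Not at hcon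
  exact no_weilDeligne_class_forced_by_spec _ hE r fun 𝔇 h𝔇 => hcon 𝔇 h𝔇

end Summit

end PstSpecTwist

end Summit.Langlands.Langlands.Theorems

end
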